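import Summits.PneNP.PneNP.Theorems.SzkEntropyPeaThreeNotInPSocketRawDefs
import Literature.Computability.Complexity.DegreeThreeEncodingMapFP
import HarnessLib

/-!
# Route SzkEntropy, crux `PeaThreeNotInP` (stmt-PneNP-10776), line `SketchIdeator3`, socket rider:
# the raw degree-3 encoding of branching programs is typed polynomial time

Stubs `stub_encodeBDDsRawFP` and `stub_toPEARawFP` of the socket rider: the raw-data functions
`encodeBDDsRaw` (consecutive degree-3 blocks of a list of raw branching programs, AIK Lemma 4.15 /
Lemma 4.9) and `toPEARaw` (raw data of the instance map `PEABP → PEA 3`, DGRV Thm 4.6) of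
`SzkEntropyPeaThreeNotInPSocketRawDefs.lean` are `CodeFP` programs between the codes of the typed
polynomial-time algebra (`CodeFP.lean`); a raw node `(tag, x, lo, hi)` is coded by
`pairE natE (pairE natE (pairE natE natE))`.

Structure (one `CodeFP` lemma per raw function, as functional programs on codes, no machine):

* §1 `codeFP_nodeOKRaw`, `codeFP_validRaw`, `codeFP_symNodeRaw`, `codeFP_symBPRaw`,
  `codeFP_symFalseRaw`, `codeFP_sizeRaw`;
* §2 the block `gBlock n₀ d symX` of a symbolic matrix COMPUTED ON CODES with a context
  (`codeFP_gSummand`, `codeFP_gEntry`, `codeFP_gPairsLE`, `codeFP_gBlock` — the `gEntry`/`gBlock`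
  analogues of `codeFP_entry`/`codeFP_ikBlock` of `DegreeThreeEncodingFP.lean`), whence
  `codeFP_encodeBDDRaw`;
* §3 the closed form `encodeBDDsRaw_closedForm` (final counter = `n₀ +` the sum of the block sizes, outputs =
  the blocks started at the prefix sums) and the two stubs, following `codeFP_encodeMap_snd/_fst`
  and `codeFP_reduceRaw` of `DegreeThreeEncodingMapFP.lean`.

## References

* S. Arora, B. Barak, *Computational Complexity: A Modern Approach*, CUP 2009, §1.3 (closure of
  polynomial time under composition and polynomially bounded loops).
* B. Applebaum, Y. Ishai, E. Kushilevitz, *Cryptography in NC⁰*, SIAM J. Comput. 36 (2006), §4.3.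
* Z. Dvir, D. Gutfreund, G. N. Rothblum, S. Vadhan, *On approximating the entropy of polynomial
  mappings*, ECCC TR10-160 (2010), Thm 4.6.
-/

namespace Summit.PneNP.PneNP.Cruxes.PeaThreeNotInP.SocketBP

set_option linter.dupNamespace false -- `Summit.PneNP.PneNP.…`: summit = sub-problem name (D-0017)

open Literature.Computability.Complexity Literature.Computability.Complexity.RandPoly
open CodeFP (natE pairE rawE listE bitE unE)

/-! ### §1 Validity, the symbolic matrices, sizes -/

/-- `nodeOKRaw n i nd` on codes (argument `((n, i), nd)`). [cite: AroraBarak2009, §1.3] -/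
theorem codeFP_nodeOKRaw :
    CodeFP (pairE (pairE natE natE) (pairE natE (pairE natE (pairE natE natE)))) bitE
      (fun c => nodeOKRaw c.1.1 c.1.2 c.2) := by
  let cE := pairE (pairE natE natE) (pairE natE (pairE natE (pairE natE natE)))
  have hN : CodeFP cE natE (fun c => c.1.1) := (CodeFP.fst _ _).fst'
  have hI : CodeFP cE natE (fun c => c.1.2) := (CodeFP.fst _ _).snd'
  have hT : CodeFP cE natE (fun c => c.2.1) := (CodeFP.snd _ _).fst'
  have hXv : CodeFP cE natE (fun c => c.2.2.1) := (CodeFP.snd _ _).snd'.fst'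
  have hLo : CodeFP cE natE (fun c => c.2.2.2.1) := (CodeFP.snd _ _).snd'.snd'.fst'
  have hHi : CodeFP cE natE (fun c => c.2.2.2.2) := (CodeFP.snd _ _).snd'.snd'.snd'
  exact ((CodeFP.natLt.comp (hT.pair (CodeFP.const _ 2))).or (((CodeFP.natLt.comp (hXv.pair hN)).and
    (CodeFP.natLt.comp (hLo.pair hI))).and (CodeFP.natLt.comp (hHi.pair hI)))).congr fun c => rfl

/-- `validRaw n B` on codes (argument `(n, B)`): `all` over the range of positions, each node
fetched by `rawGetOr`. [cite: AroraBarak2009, §1.3] -/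
theorem codeFP_validRaw :
    CodeFP (pairE natE (rawE (pairE natE (pairE natE (pairE natE natE))))) bitE
      (fun c => validRaw c.1 c.2) := by
  let ndE := pairE natE (pairE natE (pairE natE natE))
  let cE := pairE natE (rawE ndE)
  have h0 : CodeFP cE bitE (fun c => decide (0 < c.2.length)) :=
    CodeFP.natLt.comp ((CodeFP.const _ 0).pair ((CodeFP.natLength _).comp (CodeFP.snd _ _)))
  have hget : CodeFP (pairE cE natE) ndE (fun t => t.1.2.getD t.2 (0, 0, 0, 0)) :=
    (CodeFP.rawGetOr _).comp ((CodeFP.fst _ _).snd'.pair ((CodeFP.snd _ _).pair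
      (CodeFP.const _ ((0 : ℕ), (0 : ℕ), (0 : ℕ), (0 : ℕ)))))
  have hitem : CodeFP (pairE cE natE) bitE (fun t => nodeOKRaw t.1.1 t.2 (t.1.2.getD t.2 (0, 0, 0, 0))) :=
    codeFP_nodeOKRaw.comp ((((CodeFP.fst _ _).fst').pair (CodeFP.snd _ _)).pair hget)
  have hrange : CodeFP cE (rawE natE) (fun c => List.range c.2.length) :=
    CodeFP.urange.comp ((CodeFP.ulength _).comp (CodeFP.snd _ _))
  exact (h0.and ((CodeFP.all hitem).comp ((CodeFP.id cE).pair hrange))).congr fun c => rfl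

/-- `symNodeRaw nd s c` on codes (argument `(nd, s, c)`). [cite: AroraBarak2009, §1.3] -/
theorem codeFP_symNodeRaw :
    CodeFP (pairE (pairE natE (pairE natE (pairE natE natE))) (pairE natE natE)) (rawE (rawE natE))
      (fun c => symNodeRaw c.1 c.2.1 c.2.2) := by
  let cE := pairE (pairE natE (pairE natE (pairE natE natE))) (pairE natE natE)
  have hTag : CodeFP cE natE (fun c => c.1.1) := (CodeFP.fst _ _).fst'
  have hXv : CodeFP cE natE (fun c => c.1.2.1) := (CodeFP.fst _ _).snd'.fst'
  have hLo : CodeFP cE natE (fun c => c.1.2.2.1) := (CodeFP.fst _ _).snd'.snd'.fst'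
  have hHi : CodeFP cE natE (fun c => c.1.2.2.2) := (CodeFP.fst _ _).snd'.snd'.snd'
  have hS : CodeFP cE natE (fun c => c.2.1) := (CodeFP.snd _ _).fst'
  have hC : CodeFP cE natE (fun c => c.2.2) := (CodeFP.snd _ _).snd'
  have hsink : CodeFP cE (rawE (rawE natE)) (fun c => if c.2.2 = c.2.1 ∧ c.1.1 = 1 then [[]] else []) :=
    (((CodeFP.natEq.comp (hC.pair hS)).and (CodeFP.natEq.comp (hTag.pair (CodeFP.const _ 1)))).ite
      (CodeFP.const _ [[]]) (CodeFP.const _ [])).congr fun c => by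
        simp only [Bool.and_eq_true, decide_eq_true_eq]
  have hhi : CodeFP cE (rawE (rawE natE))
      (fun c => if c.2.2 + 1 + c.1.2.2.2 = c.2.1 then [[c.1.2.1]] else []) :=
    ((CodeFP.natEq.comp ((CodeFP.natAdd.comp ((CodeFP.natAdd.comp (hC.pair (CodeFP.const _ 1))).pair
      hHi)).pair hS)).ite (codeFP_varPoly.comp hXv) (CodeFP.const _ [])).congr fun c => by
        simp only [decide_eq_true_eq]
  have hlo : CodeFP cE (rawE (rawE natE))
      (fun c => if c.2.2 + 1 + c.1.2.2.1 = c.2.1 then [[], [c.1.2.1]] else []) :=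
    ((CodeFP.natEq.comp ((CodeFP.natAdd.comp ((CodeFP.natAdd.comp (hC.pair (CodeFP.const _ 1))).pair
      hLo)).pair hS)).ite ((CodeFP.rawCons (rawE natE)).comp ((CodeFP.const _ ([] : List ℕ)).pair
        (codeFP_varPoly.comp hXv))) (CodeFP.const _ [])).congr fun c => by
        simp only [decide_eq_true_eq]
  exact ((CodeFP.natLt.comp (hTag.pair (CodeFP.const _ 2))).ite hsink
    ((CodeFP.rawAppend (rawE natE)).comp (hhi.pair hlo))).congr fun c => by
      simp only [symNodeRaw, decide_eq_true_eq]

/-- `symBPRaw B r c` on codes (argument `(B, r, c)`): the node of row `r` is fetched by `rawGetOr`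
at index `|B| - r`. [cite: AroraBarak2009, §1.3] -/
theorem codeFP_symBPRaw :
    CodeFP (pairE (rawE (pairE natE (pairE natE (pairE natE natE)))) (pairE natE natE)) (rawE (rawE natE))
      (fun c => symBPRaw c.1 c.2.1 c.2.2) := by
  let ndE := pairE natE (pairE natE (pairE natE natE))
  let cE := pairE (rawE ndE) (pairE natE natE)
  have hB : CodeFP cE (rawE ndE) (fun c => c.1) := CodeFP.fst _ _
  have hR : CodeFP cE natE (fun c => c.2.1) := (CodeFP.snd _ _).fst'
  have hC : CodeFP cE natE (fun c => c.2.2) := (CodeFP.snd _ _).snd'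
  have hL : CodeFP cE natE (fun c => c.1.length) := (CodeFP.natLength _).comp hB
  have h1 : CodeFP cE (rawE (rawE natE))
      (fun c => if c.2.2 + 1 + (c.1.length - 1) = c.1.length then [[]] else []) :=
    ((CodeFP.natEq.comp ((CodeFP.natAdd.comp ((CodeFP.natAdd.comp (hC.pair (CodeFP.const _ 1))).pair
      (CodeFP.natSub.comp (hL.pair (CodeFP.const _ 1))))).pair hL)).ite (CodeFP.const _ [[]])
      (CodeFP.const _ [])).congr fun c => by simp only [decide_eq_true_eq]
  have hget : CodeFP cE ndE (fun c => c.1.getD (c.1.length - c.2.1) (0, 0, 0, 0)) :=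
    (CodeFP.rawGetOr _).comp (hB.pair ((CodeFP.natSub.comp (hL.pair hR)).pair
      (CodeFP.const _ ((0 : ℕ), (0 : ℕ), (0 : ℕ), (0 : ℕ)))))
  have h2 : CodeFP cE (rawE (rawE natE)) (fun c => if c.2.1 ≤ c.1.length ∧ 0 < c.2.1 then
      symNodeRaw (c.1.getD (c.1.length - c.2.1) (0, 0, 0, 0)) c.1.length c.2.2 else []) :=
    (((CodeFP.natLe.comp (hR.pair hL)).and (CodeFP.natLt.comp ((CodeFP.const _ 0).pair hR))).ite
      (codeFP_symNodeRaw.comp (hget.pair (hL.pair hC))) (CodeFP.const _ [])).congr fun c => by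
        simp only [Bool.and_eq_true, decide_eq_true_eq]
  have h12 : CodeFP cE (rawE (rawE natE)) (fun c =>
      if c.2.1 = 0 then (if c.2.2 + 1 + (c.1.length - 1) = c.1.length then [[]] else [])
      else if c.2.1 ≤ c.1.length ∧ 0 < c.2.1 then
        symNodeRaw (c.1.getD (c.1.length - c.2.1) (0, 0, 0, 0)) c.1.length c.2.2 else []) :=
    ((CodeFP.natEq.comp (hR.pair (CodeFP.const _ 0))).ite h1 h2).congr fun c => by
      simp only [decide_eq_true_eq]
  have h3 : CodeFP cE (rawE (rawE natE)) (fun c => if c.2.1 = c.2.2 + 1 then [[]] else []) :=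
    ((CodeFP.natEq.comp (hR.pair (CodeFP.natAdd.comp (hC.pair (CodeFP.const _ 1))))).ite
      (CodeFP.const _ [[]]) (CodeFP.const _ [])).congr fun c => by simp only [decide_eq_true_eq]
  exact ((CodeFP.rawAppend (rawE natE)).comp (h12.pair h3)).congr fun c => rfl

/-- `symFalseRaw r c` on codes (argument `(r, c)`). [cite: AroraBarak2009, §1.3] -/
theorem codeFP_symFalseRaw : CodeFP (pairE natE natE) (rawE (rawE natE)) (fun c => symFalseRaw c.1 c.2) := by
  have hR : CodeFP (pairE natE natE) natE (fun c => c.1) := CodeFP.fst _ _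
  have hC : CodeFP (pairE natE natE) natE (fun c => c.2) := CodeFP.snd _ _
  have h1 : CodeFP (pairE natE natE) (rawE (rawE natE)) (fun c => if c.2 = 0 then [[]] else []) :=
    ((CodeFP.natEq.comp (hC.pair (CodeFP.const _ 0))).ite (CodeFP.const _ [[]]) (CodeFP.const _ [])).congr
      fun c => by simp only [decide_eq_true_eq]
  have h2 : CodeFP (pairE natE natE) (rawE (rawE natE))
      (fun c => if c.1 = 0 then (if c.2 = 0 then [[]] else []) else []) :=
    ((CodeFP.natEq.comp (hR.pair (CodeFP.const _ 0))).ite h1 (CodeFP.const _ [])).congr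
      fun c => by simp only [decide_eq_true_eq]
  have h3 : CodeFP (pairE natE natE) (rawE (rawE natE)) (fun c => if c.1 = c.2 + 1 then [[]] else []) :=
    ((CodeFP.natEq.comp (hR.pair (CodeFP.natAdd.comp (hC.pair (CodeFP.const _ 1))))).ite
      (CodeFP.const _ [[]]) (CodeFP.const _ [])).congr fun c => by simp only [decide_eq_true_eq]
  exact ((CodeFP.rawAppend (rawE natE)).comp (h2.pair h3)).congr fun c => rfl

/-- `sizeRaw n B` on codes (argument `(n, B)`). [cite: AroraBarak2009, §1.3] -/
theorem codeFP_sizeRaw :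
    CodeFP (pairE natE (rawE (pairE natE (pairE natE (pairE natE natE))))) natE (fun c => sizeRaw c.1 c.2) :=
  (codeFP_validRaw.ite ((CodeFP.natLength _).comp (CodeFP.snd _ _)) (CodeFP.const _ 1)).congr fun _ => rfl

/-! ### §2 The block of a symbolic matrix computed on codes -/

/-- The summand of `gEntry` for a symbolic matrix with a context `s`:
`(s, (i, k), (j, l)) ↦ R₁[i,j] · X_s[j,l] · R₂[l,k]`. [cite: AroraBarak2009, §1.3] -/
theorem codeFP_gSummand {σ : Type} {eσ : σ → List Bool} {symX : σ → ℕ → ℕ → List (List ℕ)}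
    {n0 d : σ → ℕ}
    (hX : CodeFP (pairE eσ (pairE natE natE)) (rawE (rawE natE)) (fun c => symX c.1 c.2.1 c.2.2))
    (hn0 : CodeFP eσ natE n0) (hd : CodeFP eσ natE d) :
    CodeFP (pairE eσ (pairE (pairE natE natE) (pairE natE natE))) (rawE (rawE natE))
      (fun c => mulP (mulP (symR1 (n0 c.1) c.2.1.1 c.2.2.1) (symX c.1 c.2.2.1 c.2.2.2))
        (symR2 (n0 c.1) (d c.1) c.2.2.2 c.2.1.2)) := by
  let cE := pairE eσ (pairE (pairE natE natE) (pairE natE natE))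
  have hS : CodeFP cE eσ (fun c => c.1) := CodeFP.fst _ _
  have hI : CodeFP cE natE (fun c => c.2.1.1) := (CodeFP.snd _ _).fst'.fst'
  have hK : CodeFP cE natE (fun c => c.2.1.2) := (CodeFP.snd _ _).fst'.snd'
  have hJ : CodeFP cE natE (fun c => c.2.2.1) := (CodeFP.snd _ _).snd'.fst'
  have hL : CodeFP cE natE (fun c => c.2.2.2) := (CodeFP.snd _ _).snd'.snd'
  have hR1 := codeFP_symR1.comp ((hn0.comp hS).pair (hI.pair hJ))
  have hXm := hX.comp (hS.pair (hJ.pair hL))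
  have hR2 := codeFP_symR2.comp (((hn0.comp hS).pair (hd.comp hS)).pair (hL.pair hK))
  exact (codeFP_mulP.comp ((codeFP_mulP.comp (hR1.pair hXm)).pair hR2)).congr fun c => rfl

/-- `gEntry (n0 s) (d s) (symX s) i k` on codes (argument `(s, i, k)`), given the range `[0, d s]`
on codes (the unary budget of the two loops). [cite: AroraBarak2009, §1.3] -/
theorem codeFP_gEntry {σ : Type} {eσ : σ → List Bool} {symX : σ → ℕ → ℕ → List (List ℕ)}
    {n0 d : σ → ℕ}
    (hX : CodeFP (pairE eσ (pairE natE natE)) (rawE (rawE natE)) (fun c => symX c.1 c.2.1 c.2.2))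
    (hn0 : CodeFP eσ natE n0) (hd : CodeFP eσ natE d)
    (hrange : CodeFP eσ (rawE natE) (fun s => List.range (d s + 1))) :
    CodeFP (pairE eσ (pairE natE natE)) (rawE (rawE natE))
      (fun c => gEntry (n0 c.1) (d c.1) (symX c.1) c.2.1 c.2.2) := by
  let cE := pairE eσ (pairE natE natE)
  let c2E := pairE cE natE
  have hsum2 : CodeFP (pairE c2E natE) (rawE (rawE natE))
      (fun c => mulP (mulP (symR1 (n0 c.1.1.1) c.1.1.2.1 c.1.2) (symX c.1.1.1 c.1.2 c.2))
        (symR2 (n0 c.1.1.1) (d c.1.1.1) c.2 c.1.1.2.2)) :=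
    (codeFP_gSummand hX hn0 hd).comp (((CodeFP.fst _ _).fst'.fst').pair
      (((CodeFP.fst _ _).fst'.snd').pair (((CodeFP.fst _ _).snd').pair (CodeFP.snd _ _))))
  have hrange1 : CodeFP cE (rawE natE) (fun c => List.range (d c.1 + 1)) := hrange.comp (CodeFP.fst _ _)
  have hinner : CodeFP c2E (rawE (rawE natE)) (fun c => (List.range (d c.1.1 + 1)).flatMap fun l =>
      mulP (mulP (symR1 (n0 c.1.1) c.1.2.1 c.2) (symX c.1.1 c.2 l)) (symR2 (n0 c.1.1) (d c.1.1) l c.1.2.2)) :=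
    ((CodeFP.flatten (rawE natE)).comp ((CodeFP.map (σ := (σ × ℕ × ℕ) × ℕ) (α := ℕ) hsum2).comp
      ((CodeFP.id c2E).pair (hrange1.comp (CodeFP.fst _ _))))).congr fun c => by
        rw [List.flatMap_def]; rfl
  exact ((CodeFP.flatten (rawE natE)).comp ((CodeFP.map (σ := σ × ℕ × ℕ) (α := ℕ) hinner).comp
    ((CodeFP.id cE).pair hrange1))).congr fun c => by
      rw [gEntry, List.flatMap_def]; rfl

/-- `pairsLE (d s)` on codes, given the range `[0, d s]` on codes. [cite: AroraBarak2009, §1.3] -/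
theorem codeFP_gPairsLE {σ : Type} {eσ : σ → List Bool} {d : σ → ℕ}
    (hrange : CodeFP eσ (rawE natE) (fun s => List.range (d s + 1))) :
    CodeFP eσ (rawE (pairE natE natE)) (fun s => pairsLE (d s)) := by
  have hrow : CodeFP (pairE eσ natE) (rawE (pairE natE natE))
      (fun c => ((List.range (d c.1 + 1)).filter fun k => decide (c.2 ≤ k)).map fun k => (c.2, k)) := by
    have hfilt : CodeFP (pairE eσ natE) (rawE natE)
        (fun c => (List.range (d c.1 + 1)).filter fun k => decide (c.2 ≤ k)) :=
      (CodeFP.filter (σ := σ × ℕ) (α := ℕ) (CodeFP.natLe.comp ((CodeFP.fst _ _).snd'.pair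
        (CodeFP.snd _ _)))).comp ((CodeFP.id _).pair (hrange.comp (CodeFP.fst _ _)))
    exact (CodeFP.map (σ := σ × ℕ) (α := ℕ) ((CodeFP.fst _ _).snd'.pair (CodeFP.snd _ _))).comp
      ((CodeFP.id _).pair hfilt)
  exact ((CodeFP.flatten (pairE natE natE)).comp ((CodeFP.map (σ := σ) (α := ℕ) hrow).comp
    ((CodeFP.id eσ).pair hrange))).congr fun s => by
      rw [pairsLE, List.flatMap_def]; rfl

/-- **The block `gBlock (n0 s) (d s) (symX s)` of a symbolic matrix computed on codes is computed
on codes**, given the range `[0, d s]` on codes. [cite: AroraBarak2009, §1.3] -/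
theorem codeFP_gBlock {σ : Type} {eσ : σ → List Bool} {symX : σ → ℕ → ℕ → List (List ℕ)}
    {n0 d : σ → ℕ}
    (hX : CodeFP (pairE eσ (pairE natE natE)) (rawE (rawE natE)) (fun c => symX c.1 c.2.1 c.2.2))
    (hn0 : CodeFP eσ natE n0) (hd : CodeFP eσ natE d)
    (hrange : CodeFP eσ (rawE natE) (fun s => List.range (d s + 1))) :
    CodeFP eσ (rawE (rawE (rawE natE))) (fun s => gBlock (n0 s) (d s) (symX s)) :=
  ((CodeFP.map (σ := σ) (α := ℕ × ℕ) (codeFP_gEntry hX hn0 hd hrange)).comp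
    ((CodeFP.id eσ).pair (codeFP_gPairsLE hrange))).congr fun _ => rfl

/-- **`encodeBDDRaw n₀ n B` on codes** (argument `(n₀, n, B)`): the block of `symBPRaw B` with
`d = |B|` (budget `|B| + 1` from the list) if valid, of `symFalseRaw` with `d = 1` otherwise.
(The context type `σ` and its code are given explicitly: elaborating the named arguments
`symX`/`n0`/`d` against an unknown `σ` does not terminate in time.) [cite: AroraBarak2009, §1.3] -/
theorem codeFP_encodeBDDRaw :
    CodeFP (pairE natE (pairE natE (rawE (pairE natE (pairE natE (pairE natE natE))))))
      (rawE (rawE (rawE natE))) (fun c => encodeBDDRaw c.1 c.2.1 c.2.2) := by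
  let ndE := pairE natE (pairE natE (pairE natE natE))
  let cE := pairE natE (pairE natE (rawE ndE))
  have hN0 : CodeFP cE natE (fun c => c.1) := CodeFP.fst _ _
  have hB : CodeFP cE (rawE ndE) (fun c => c.2.2) := (CodeFP.snd _ _).snd'
  have hV : CodeFP cE bitE (fun c => validRaw c.2.1 c.2.2) := codeFP_validRaw.comp (CodeFP.snd _ _)
  have hlen : CodeFP cE natE (fun c => c.2.2.length) := (CodeFP.natLength _).comp hB
  have hrange : CodeFP cE (rawE natE) (fun c => List.range (c.2.2.length + 1)) :=
    CodeFP.urange.comp (CodeFP.unSucc.comp ((CodeFP.ulength _).comp hB))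
  have hX : CodeFP (pairE cE (pairE natE natE)) (rawE (rawE natE)) (fun c => symBPRaw c.1.2.2 c.2.1 c.2.2) :=
    codeFP_symBPRaw.comp ((CodeFP.fst _ _).snd'.snd'.pair (CodeFP.snd _ _))
  have hvalid : CodeFP cE (rawE (rawE (rawE natE))) (fun c => gBlock c.1 c.2.2.length (symBPRaw c.2.2)) :=
    codeFP_gBlock (σ := ℕ × ℕ × List (ℕ × ℕ × ℕ × ℕ)) (eσ := cE) (symX := fun c => symBPRaw c.2.2)
      (n0 := fun c => c.1) (d := fun c => c.2.2.length) hX hN0 hlen hrange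
  have hF : CodeFP (pairE cE (pairE natE natE)) (rawE (rawE natE)) (fun c => symFalseRaw c.2.1 c.2.2) :=
    codeFP_symFalseRaw.comp (CodeFP.snd _ _)
  have hrange2 : CodeFP cE (rawE natE) (fun _ => List.range (1 + 1)) := CodeFP.const _ (List.range 2)
  have hinvalid : CodeFP cE (rawE (rawE (rawE natE))) (fun c => gBlock c.1 1 symFalseRaw) :=
    codeFP_gBlock (σ := ℕ × ℕ × List (ℕ × ℕ × ℕ × ℕ)) (eσ := cE) (symX := fun _ => symFalseRaw)
      (n0 := fun c => c.1) (d := fun _ => 1) hF hN0 (CodeFP.const _ 1) hrange2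
  exact (hV.ite hvalid hinvalid).congr fun c => rfl

/-! ### §3 The list level: closed form and the two stubs -/

/-- **Closed form of `encodeBDDsRaw`**: the final counter is `n₀` plus the sum of the block sizes
`pos s s`, `s = sizeRaw n B`, and the outputs are the blocks of the programs started at the prefix
sums. [folklore] -/
theorem encodeBDDsRaw_closedForm (n n₀ : ℕ) (Bs : List (List (ℕ × ℕ × ℕ × ℕ))) :
    encodeBDDsRaw n n₀ Bs =
      (n₀ + (Bs.map fun B => pos (sizeRaw n B) (sizeRaw n B)).sum,
        (List.range Bs.length).flatMap fun i =>
          encodeBDDRaw (n₀ + ((Bs.take i).map fun B => pos (sizeRaw n B) (sizeRaw n B)).sum) n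
            (Bs.getD i [])) := by
  induction Bs generalizing n₀ with
  | nil => simp [encodeBDDsRaw]
  | cons B Bs ih =>
    simp only [encodeBDDsRaw]
    rw [ih]
    refine Prod.ext ?_ ?_
    · simp only [List.map_cons, List.sum_cons, Nat.add_assoc]
    · show encodeBDDRaw n₀ n B ++ _ = _
      rw [List.length_cons, flatMap_range_succ]
      simp only [List.take_zero, List.map_nil, List.sum_nil, Nat.add_zero, List.getD_cons_zero,
        List.take_succ_cons, List.map_cons, List.sum_cons, List.getD_cons_succ, Nat.add_assoc]

/-- **Stub `stub_encodeBDDsRawFP`: `encodeBDDsRaw n n₀ Bs` is computed on codes** (argument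
`(n, n₀, Bs)`), through the closed form: prefix sums by `take`/`map`/`natSum`, blocks by `map`
over the range of indices with context, `flatten`. [cite: AroraBarak2009, §1.3] -/
theorem stub_encodeBDDsRawFP : CodeFP (pairE natE (pairE natE (rawE (rawE (pairE natE (pairE natE (pairE natE natE))))))) (pairE natE (rawE (rawE (rawE natE)))) (fun c => encodeBDDsRaw c.1 c.2.1 c.2.2) := by
  let ndE := pairE natE (pairE natE (pairE natE natE))
  let cE := pairE natE (pairE natE (rawE (rawE ndE)))
  have hN : CodeFP cE natE (fun c => c.1) := CodeFP.fst _ _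
  have hN0 : CodeFP cE natE (fun c => c.2.1) := (CodeFP.snd _ _).fst'
  have hBs : CodeFP cE (rawE (rawE ndE)) (fun c => c.2.2) := (CodeFP.snd _ _).snd'
  have hps : CodeFP (pairE natE (rawE ndE)) natE (fun c => pos (sizeRaw c.1 c.2) (sizeRaw c.1 c.2)) :=
    codeFP_pos.comp (codeFP_sizeRaw.pair codeFP_sizeRaw)
  have hsum : CodeFP (pairE natE (rawE (rawE ndE))) natE
      (fun c => (c.2.map fun B => pos (sizeRaw c.1 B) (sizeRaw c.1 B)).sum) :=
    CodeFP.natSum.comp (CodeFP.map (σ := ℕ) (α := List (ℕ × ℕ × ℕ × ℕ)) hps)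
  -- item `i` with context `c = (n, n₀, Bs)`
  have hpre : CodeFP (pairE cE natE) natE (fun t => t.1.2.1 +
      ((t.1.2.2.take t.2).map fun B => pos (sizeRaw t.1.1 B) (sizeRaw t.1.1 B)).sum) :=
    CodeFP.natAdd.comp ((CodeFP.fst _ _).snd'.fst'.pair (hsum.comp ((CodeFP.fst _ _).fst'.pair
      ((codeFP_takeNat (rawE ndE)).comp ((CodeFP.snd _ _).pair (CodeFP.fst _ _).snd'.snd')))))
  have hget : CodeFP (pairE cE natE) (rawE ndE) (fun t => t.1.2.2.getD t.2 []) :=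
    (CodeFP.rawGetD (rawE ndE) (d := []) rfl).comp ((CodeFP.fst _ _).snd'.snd'.pair (CodeFP.snd _ _))
  have hitem : CodeFP (pairE cE natE) (rawE (rawE (rawE natE))) (fun t => encodeBDDRaw (t.1.2.1 +
      ((t.1.2.2.take t.2).map fun B => pos (sizeRaw t.1.1 B) (sizeRaw t.1.1 B)).sum) t.1.1
        (t.1.2.2.getD t.2 [])) :=
    codeFP_encodeBDDRaw.comp (hpre.pair ((CodeFP.fst _ _).fst'.pair hget))
  have hrange : CodeFP cE (rawE natE) (fun c => List.range c.2.2.length) :=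
    CodeFP.urange.comp ((CodeFP.ulength (rawE ndE)).comp hBs)
  have hsnd : CodeFP cE (rawE (rawE (rawE natE))) (fun c => ((List.range c.2.2.length).map fun i =>
      encodeBDDRaw (c.2.1 + ((c.2.2.take i).map fun B => pos (sizeRaw c.1 B) (sizeRaw c.1 B)).sum) c.1
        (c.2.2.getD i [])).flatten) :=
    (CodeFP.flatten (rawE (rawE natE))).comp ((CodeFP.map (σ := ℕ × ℕ × List (List (ℕ × ℕ × ℕ × ℕ)))
      (α := ℕ) hitem).comp ((CodeFP.id cE).pair hrange))
  have hfst : CodeFP cE natE (fun c => c.2.1 + (c.2.2.map fun B => pos (sizeRaw c.1 B) (sizeRaw c.1 B)).sum) :=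
    CodeFP.natAdd.comp (hN0.pair (hsum.comp (hN.pair hBs)))
  exact (hfst.pair hsnd).congr fun c => by rw [encodeBDDsRaw_closedForm, List.flatMap_def]

/-- **Stub `stub_toPEARawFP`: the raw instance map `toPEARaw` of `PEABP → PEA 3` is typed
polynomial time** between the codes of the instances (headed lists converted to raw lists and
back, as in `codeFP_reduceRaw`). [cite: AroraBarak2009, §1.3] -/
theorem stub_toPEARawFP : CodeFP (pairE natE (pairE (listE (listE (pairE natE (pairE natE (pairE natE natE))))) natE)) (pairE natE (pairE (listE (listE (listE natE))) natE)) toPEARaw := by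
  let ndE := pairE natE (pairE natE (pairE natE natE))
  let inE := pairE natE (pairE (listE (listE ndE)) natE)
  have hraw : CodeFP (listE (listE ndE)) (rawE (rawE ndE)) id :=
    ((CodeFP.map₀ (CodeFP.rawOfList ndE)).comp (CodeFP.rawOfList (listE ndE))).congr fun Bs => by simp
  have hhead : CodeFP (rawE (rawE (rawE natE))) (listE (listE (listE natE))) id :=
    ((CodeFP.listOfRaw (listE (listE natE))).comp (CodeFP.map₀ ((CodeFP.listOfRaw (listE natE)).comp
      (CodeFP.map₀ (CodeFP.listOfRaw natE))))).congr fun P => by simp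
  have hN : CodeFP inE natE (fun c => c.1) := CodeFP.fst _ _
  have hBs : CodeFP inE (rawE (rawE ndE)) (fun c => c.2.1) := hraw.comp (CodeFP.snd _ _).fst'
  have hK : CodeFP inE natE (fun c => c.2.2) := (CodeFP.snd _ _).snd'
  -- No type ascriptions from here on: the unifier must never face `encodeBDDsRaw x =?= encodeBDDsRaw y`
  -- with `x`, `y` not syntactically equal (it unfolds the structural recursion and times out); the
  -- projections of the argument triple are reduced by `dsimp` instead.
  have hE := stub_encodeBDDsRawFP.comp (hN.pair (hN.pair hBs))
  have hP' := hhead.comp hE.snd'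
  have hK' := CodeFP.natAdd.comp (hK.pair (CodeFP.natSub.comp (hE.fst'.pair hN)))
  exact (hE.fst'.pair (hP'.pair hK')).congr fun c => by dsimp only [toPEARaw, id_eq]

end Summit.PneNP.PneNP.Cruxes.PeaThreeNotInP.SocketBP
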